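import Literature.Probability.FitznerVanDerHofstad2017.NobleBoundsNCover
import Literature.Probability.FitznerVanDerHofstad2017.NobleBlocksAvgPerc
import Literature.Probability.FitznerVanDerHofstad2017.NobleBlocksPointwise
import HarnessLib

/-!
# [FvdH17] Prop. 5.5 (5.34) and Prop. 5.6 (5.37) at every `N ≥ 2` FROM the percolation estimates — the assembly

R. Fitzner and R. van der Hofstad, *Mean-field behavior for nearest-neighbor percolation in `d > 10`*,
Electron. J. Probab. **22** (2017) no. 43; arXiv:1506.07977v2 — Prop. 5.5 (5.34) "`Σ_x Ξ^{(N)}(x) ≤ P⃗^S (B^ι)^{N−1}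
Ā^ι P⃗^E`" and Prop. 5.6 (5.37) "`Σ_x Ξ^{(N),ι}(x) ≤ P⃗^ι (B^ι)^{N−1} Ā^ι P⃗^E`" (p. 53); §6.2.1 (pp. 65–67):
"The first step is to prove a pointwise bound on the coefficients. In order to do this, we combine the building
blocks to construct the bounding diagrams. … (6.49) `P^{(N),b}(u_N,w_N) = Σ_{u_{N−1},w_{N−1}} Σ_κ Σ_a
P^{(N−1),b}(u_{N−1},w_{N−1}) B^{κ,a,b}(u_{N−1},w_{N−1},w_N,u_N)` … Lemma 6.1 (x-space bounds) … Performing a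
consideration of cases for `a_i` … To prove the bounds for all `N` we use induction on `N`. The proof for `Ξ^ι`
differs only in the different initial block of the bounding diagram. Once the x-wise bounds of Lemma 6.1 are
proven, we use a split as demonstrated in (6.4)–(6.5) to conclude the bounds stated in Propositions 5.5 and 5.6."

## What this module is

The END-TO-END ASSEMBLY of (5.34)/(5.37) at `N = n + 1` for bond percolation on `ℤ^d` (every `d`), with EXACTLY the
percolation content left as hypotheses, in their final typed shape:
* a finite COVER of the bounding events of `Ξ^{(n+1)}(x)` (resp. `Ξ^{(n+1),ι}(x)`) in product form — `h1` (the
  joint-witness / nested form, weights `J(b) = Π_i p D(v_i − u_i)` as `∏ i, ofReal (bondJ …)`, measure `piPerc d p (n+2)`)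
  and `hC` (every configuration of the event lies in some class cell `C … a c`, `a : Fin (n+1) → Fin 3` the classes of
  the lines `(u_i,w_i)`, `c` the class of the last internal line);
* the CLASS ESTIMATES `h2`, pointwise in all vertices: `J(b) · ℙ(E ∩ C a c) ≤ Σ_κ 𝟙{v_i = u_i + e_{κ_i} ∀ i} ·
  P^{S,a_0}(u_0,w_0) · Π_{i<n} Bpt^{κ_i,a_i,a_{i+1}}(u_i,w_i,t_i,z_i,w_{i+1},u_{i+1}) · Ā'^{κ_n,a_n,c}(u_n,w_n,t_n,z_n) ·
  P^{E,c}(t_n−x,z_n−x)` with the POINTWISE middle block `Bpt = blockBFullpt 𝐋` of `NobleBlocksPointwise` ((5.4) with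
  its internal pair exposed; `Σ_{t,z} blockBFullpt = blockBFull`), the primed double-open triangle `blockAbar' 𝐋`
  (`NobleBlocksPrime`) and the letters `𝐋 = Letters.perc d p`;
and EVERYTHING ELSE discharged by name: the class split and the `[0,∞]` regrouping into the recursive `P^{(n)} =
recP (blockPS 𝐋) (blockBFull 𝐋) n` (`NobleBoundsNClasses`, `NobleBoundsNCover`), the block summation
(`NobleBlocksPointwise.blockBFullpt_hBpt`), and the `x`-summation (6.4)–(6.5) with the p. 59 class-1 averaged
terminal element (`NobleBlocksAvgPerc`) or the printed `sup` element `Ā^ι'` (`BlockSummation.tsum_le_vecMul_pow_dotProduct'`).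

* `mul_measure_le_sum₃_of_cover` — the union-bound step for a `κ_0`-dependent start piece;
* `nobleXiT_le_recP_perc_of_cover` — Lemma 6.1 (6.51)-form at `x` from (cover, class estimates);
* `tsum_nobleXiT_le_of_cover` — **(5.34) at `N = n+1`** with the averaged element `(Ā^ι)'_avg`;
  `tsum_nobleXiT_le_matAbarIota'_of_cover` — with the printed element `matAbarIota' 𝐋`;
* `sum_kdeltaPref_add_blockPiota_le_piotaFull` and `invTwoD_mul_sum_tsum_le_of_cover` — **(5.37) at `N = n+1`**,
  `ι`-summed with the trivial term (`vecPiota 𝐋`), from per-`ι` covers and class estimates whose start piece is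
  `δ_{0,a}δ_{κ_0,ι}𝟙{u_0=0}𝟙{w_0=0} + P^{ι,a_0}(u_0,w_0)`.

No percolation estimate is proved here; nothing is cited as a fact; no statement of record is touched.
-/

noncomputable section

namespace Literature.Probability.FitznerVanDerHofstad2017

open _root_.MeasureTheory Literature.Probability.LatticeModels Literature.Probability.Percolation
open Literature.Probability.FitznerVanDerHofstad2017.NobleBlocks
open Literature.Probability.FitznerVanDerHofstad2017.BlockSummation
open Literature.Barriers.CriticalPhenomena
open scoped BigOperators ENNReal Matrix

variable {d : ℕ}

/-! ### 0. The union-bound step with a start piece depending on the first direction -/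

/-- If `E ⊆ ⋃_{a,c} C(a,c)` (finitely many cells) and `J · μ(E ∩ C(a,c)) ≤ Σ_κ R(κ,a,c)` for every cell, then
`J · μ(E) ≤ Σ_κ Σ_a Σ_c R(κ,a,c)`. [folklore] -/
theorem mul_measure_le_sum₃_of_cover {Ω α γ K : Type*} [MeasurableSpace Ω] [Fintype α] [Fintype γ] [Fintype K]
    (μ : Measure Ω) (E : Set Ω) (C : α → γ → Set Ω) (hC : E ⊆ ⋃ a, ⋃ c, C a c) (J : ℝ≥0∞)
    (R : K → α → γ → ℝ≥0∞) (h : ∀ a c, J * μ (E ∩ C a c) ≤ ∑ κ, R κ a c) :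
    J * μ E ≤ ∑ κ, ∑ a, ∑ c, R κ a c := by
  classical
  calc J * μ E ≤ J * ∑ a, ∑ c, μ (E ∩ C a c) :=
        mul_le_mul' le_rfl (measure_le_sum_sum_inter_of_subset μ E C hC)
    _ = ∑ a, ∑ c, J * μ (E ∩ C a c) := by
        rw [Finset.mul_sum]; exact Finset.sum_congr rfl fun a _ => Finset.mul_sum _ _ _
    _ ≤ ∑ a, ∑ c, ∑ κ, R κ a c := Finset.sum_le_sum fun a _ => Finset.sum_le_sum fun c _ => h a c
    _ = ∑ a, ∑ κ, ∑ c, R κ a c := Finset.sum_congr rfl fun a _ => Finset.sum_comm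
    _ = ∑ κ, ∑ a, ∑ c, R κ a c := Finset.sum_comm

section Perc

variable (p : unitInterval)

local notation "𝐋" => Letters.perc d p

/-! ### 1. (5.34) at `N = n + 1` from a cover and the class estimates -/

/-- **Lemma 6.1, (6.51)-form, at `x`, FROM THE PERCOLATION ESTIMATES.**  Given a finite cover `(E, C)` of the
bounding events of `Ξ^{(n+1)}(x)` in product form (`h1`, `hC`) and the pointwise class estimates `h2` against the
chain `P^{S,a_0} · Π_{i<n} blockBFullpt · Ā' · P^E` with bond indicators `dirInd stepVec κ b`, the `x`-space bound
`Ξ^{(n+1)}(x) ≤ Σ_{u,w,t,z} Σ_{κ,a,c} P^{(n),a}(u,w) Ā'^{κ,a,c}(u,w,t,z) P^{E,c}(t−x,z−x)` holds with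
`P^{(n)} = recP (blockPS 𝐋) (blockBFull 𝐋) n` ((6.49)).
[cite: FitznerVanDerHofstad2017, Lemma 6.1 (6.48)–(6.51) and §6.2.1 (arXiv:1506.07977v2 pp. 65–67); §5.1 (5.4) (p. 48)] -/
theorem nobleXiT_le_recP_perc_of_cover (x : Site d) (n : ℕ)
    (E : (Fin (n + 1) → Site d × Site d) → (Fin (n + 1) → Site d) → (Fin (n + 1) → Site d) →
      (Fin (n + 1) → Site d) → Set (Fin (n + 2) → BondConfig (Site d)))
    (C : (Fin (n + 1) → Site d × Site d) → (Fin (n + 1) → Site d) → (Fin (n + 1) → Site d) →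
      (Fin (n + 1) → Site d) → (Fin (n + 1) → Fin 3) → Fin 3 → Set (Fin (n + 2) → BondConfig (Site d)))
    (hC : ∀ b w t z, E b w t z ⊆ ⋃ a, ⋃ c, C b w t z a c)
    (h1 : nobleXiT d p (n + 1) x ≤ ∑' b : Fin (n + 1) → Site d × Site d, ∑' w : Fin (n + 1) → Site d,
      ∑' t : Fin (n + 1) → Site d, ∑' z : Fin (n + 1) → Site d,
        (∏ i, ENNReal.ofReal (bondJ d p ((b i).2 - (b i).1))) * piPerc d p (n + 2) (E b w t z))
    (h2 : ∀ (a : Fin (n + 1) → Fin 3) (c : Fin 3) (b : Fin (n + 1) → Site d × Site d)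
      (w t z : Fin (n + 1) → Site d),
      (∏ i, ENNReal.ofReal (bondJ d p ((b i).2 - (b i).1))) * piPerc d p (n + 2) (E b w t z ∩ C b w t z a c) ≤
        ∑ κ : Fin (n + 1) → Fin d × Bool, dirInd stepVec κ b *
          (blockPS 𝐋 (a 0) (b 0).1 (w 0) * chainTail (blockBFullpt 𝐋) (blockAbar' 𝐋) (blockPE 𝐋) x n κ a c b w t z)) :
    nobleXiT d p (n + 1) x ≤ ∑' u, ∑' w, ∑' t, ∑' z, ∑ κ : Fin d × Bool, ∑ a : Fin 3, ∑ c : Fin 3,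
      recP (blockPS 𝐋) (blockBFull 𝐋) n a u w * blockAbar' 𝐋 κ a c u w t z * blockPE 𝐋 c (t - x) (z - x) :=
  nobleXiT_le_recP_chain_of_cover p x n (blockPS 𝐋) (blockBFull 𝐋) (blockBFullpt 𝐋) (blockBFullpt_hBpt 𝐋)
    (blockAbar' 𝐋) (blockPE 𝐋) E C hC h1 h2

/-- **Prop. 5.5 (5.34) at `N = n + 1 ≥ 1` FROM THE PERCOLATION ESTIMATES**, with the p. 59 class-1 averaged terminal
element `(Ā^ι)'_avg` (`≤` the printed `sup` element entrywise, `matAbarAvg_blockAbar'_le_matAbarIota'`):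
`Σ_x Ξ^{(n+1)}(x) ≤ P⃗^S · B^n · (Ā^ι)'_avg · P⃗^E` — given, for every `x`, a finite cover of the bounding events in
product form and the pointwise class estimates against `blockPS · Π blockBFullpt · blockAbar' · blockPE`.
[cite: FitznerVanDerHofstad2017, Prop. 5.5 (5.34) (arXiv:1506.07977v2 p. 53); Lemma 6.1 and §6.2.1 (pp. 65–67); §6.1 (6.4)–(6.5) (p. 58), p. 59] -/
theorem tsum_nobleXiT_le_of_cover (n : ℕ)
    (E : Site d → (Fin (n + 1) → Site d × Site d) → (Fin (n + 1) → Site d) → (Fin (n + 1) → Site d) →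
      (Fin (n + 1) → Site d) → Set (Fin (n + 2) → BondConfig (Site d)))
    (C : Site d → (Fin (n + 1) → Site d × Site d) → (Fin (n + 1) → Site d) → (Fin (n + 1) → Site d) →
      (Fin (n + 1) → Site d) → (Fin (n + 1) → Fin 3) → Fin 3 → Set (Fin (n + 2) → BondConfig (Site d)))
    (hC : ∀ x b w t z, E x b w t z ⊆ ⋃ a, ⋃ c, C x b w t z a c)
    (h1 : ∀ x, nobleXiT d p (n + 1) x ≤ ∑' b : Fin (n + 1) → Site d × Site d, ∑' w : Fin (n + 1) → Site d,
      ∑' t : Fin (n + 1) → Site d, ∑' z : Fin (n + 1) → Site d,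
        (∏ i, ENNReal.ofReal (bondJ d p ((b i).2 - (b i).1))) * piPerc d p (n + 2) (E x b w t z))
    (h2 : ∀ x (a : Fin (n + 1) → Fin 3) (c : Fin 3) (b : Fin (n + 1) → Site d × Site d)
      (w t z : Fin (n + 1) → Site d),
      (∏ i, ENNReal.ofReal (bondJ d p ((b i).2 - (b i).1))) * piPerc d p (n + 2) (E x b w t z ∩ C x b w t z a c) ≤
        ∑ κ : Fin (n + 1) → Fin d × Bool, dirInd stepVec κ b *
          (blockPS 𝐋 (a 0) (b 0).1 (w 0) * chainTail (blockBFullpt 𝐋) (blockAbar' 𝐋) (blockPE 𝐋) x n κ a c b w t z)) :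
    ∑' x, nobleXiT d p (n + 1) x ≤
      vecPS 𝐋 ᵥ* matB (blockBFull 𝐋) ^ n ᵥ* matAbarAvg (unitVecs d) (fun a : Fin 3 => decide (a = 1)) (blockAbar' 𝐋)
        ⬝ᵥ vecPE 𝐋 :=
  perc_tsum_le_vecPS_pow_matAbarAvg_vecPE' p (fun x => nobleXiT d p (n + 1) x) n fun x =>
    nobleXiT_le_recP_perc_of_cover p x n (E x) (C x) (hC x) (h1 x) (h2 x)

/-- **Prop. 5.5 (5.34) at `N = n + 1 ≥ 1` with the PRINTED terminal element `Ā^ι'` (`matAbarIota' 𝐋`, the `sup`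
over the base vertex)** from the same hypotheses.
[cite: FitznerVanDerHofstad2017, Prop. 5.5 (5.34) (arXiv:1506.07977v2 p. 53); §5.1 "Elements of the bounds" (p. 49); Lemma 6.1 and §6.2.1 (pp. 65–67)] -/
theorem tsum_nobleXiT_le_matAbarIota'_of_cover (n : ℕ)
    (E : Site d → (Fin (n + 1) → Site d × Site d) → (Fin (n + 1) → Site d) → (Fin (n + 1) → Site d) →
      (Fin (n + 1) → Site d) → Set (Fin (n + 2) → BondConfig (Site d)))
    (C : Site d → (Fin (n + 1) → Site d × Site d) → (Fin (n + 1) → Site d) → (Fin (n + 1) → Site d) →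
      (Fin (n + 1) → Site d) → (Fin (n + 1) → Fin 3) → Fin 3 → Set (Fin (n + 2) → BondConfig (Site d)))
    (hC : ∀ x b w t z, E x b w t z ⊆ ⋃ a, ⋃ c, C x b w t z a c)
    (h1 : ∀ x, nobleXiT d p (n + 1) x ≤ ∑' b : Fin (n + 1) → Site d × Site d, ∑' w : Fin (n + 1) → Site d,
      ∑' t : Fin (n + 1) → Site d, ∑' z : Fin (n + 1) → Site d,
        (∏ i, ENNReal.ofReal (bondJ d p ((b i).2 - (b i).1))) * piPerc d p (n + 2) (E x b w t z))
    (h2 : ∀ x (a : Fin (n + 1) → Fin 3) (c : Fin 3) (b : Fin (n + 1) → Site d × Site d)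
      (w t z : Fin (n + 1) → Site d),
      (∏ i, ENNReal.ofReal (bondJ d p ((b i).2 - (b i).1))) * piPerc d p (n + 2) (E x b w t z ∩ C x b w t z a c) ≤
        ∑ κ : Fin (n + 1) → Fin d × Bool, dirInd stepVec κ b *
          (blockPS 𝐋 (a 0) (b 0).1 (w 0) * chainTail (blockBFullpt 𝐋) (blockAbar' 𝐋) (blockPE 𝐋) x n κ a c b w t z)) :
    ∑' x, nobleXiT d p (n + 1) x ≤ vecPS 𝐋 ᵥ* matB (blockBFull 𝐋) ^ n ᵥ* matAbarIota' 𝐋 ⬝ᵥ vecPE 𝐋 :=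
  tsum_le_vecMul_pow_dotProduct' (isTransInv_blockBFull 𝐋) (isTransInv_blockAbar' 𝐋)
    (fun x => nobleXiT d p (n + 1) x) (blockPS 𝐋) (blockPE 𝐋) n fun x =>
    nobleXiT_le_recP_perc_of_cover p x n (E x) (C x) (hC x) (h1 x) (h2 x)

/-! ### 2. (5.37) at `N = n + 1`, `ι`-summed with the trivial term -/

/-- The `ι`-start pieces sum into the `κ`-free full left piece:
`Σ_ι (δ_{0,a}δ_{κ,ι}𝟙{u=0}𝟙{w=0} + P^{ι,a}(u,w)) ≤ piotaFull^{a}(u,w)` (with equality, `sum_kdeltaPref`).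
[cite: FitznerVanDerHofstad2017, §5.1 display for `h^{ι,κ,b}` and `(P⃗^ι)_b` (arXiv:1506.07977v2 p. 49); §6.1 (6.x) (p. 59)] -/
theorem sum_kdeltaPref_add_blockPiota_le_piotaFull (L : Letters d) (κ : Fin d × Bool) (a : Fin 3) (u w : Site d) :
    ∑ ι : Fin d × Bool, (kdeltaPref ι κ a u w + blockPiota L ι a u w) ≤ piotaFull L a u w := by
  rw [Finset.sum_add_distrib, sum_kdeltaPref]
  rfl

/-- **Prop. 5.6 (5.37) at `N = n + 1 ≥ 1`, `ι`-summed with the trivial term, FROM THE PERCOLATION ESTIMATES**: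
for quantities `Ξ_ι(x)` (the `Ξ^{(n+1),ι}_p(x)`, `ι` the direction of the first bond) each admitting, at every `x`, a
finite cover of its bounding events in product form (`h1`, `hC`) and pointwise class estimates whose START piece is
`δ_{0,a_0}δ_{κ_0,ι}𝟙{u_0=0}𝟙{w_0=0} + P^{ι,a_0}(u_0,w_0)` (`kdeltaPref ι (κ 0) (a 0) … + blockPiota 𝐋 ι (a 0) …`) followed
by the same chain `Π blockBFullpt · blockAbar' · blockPE`:
`(2d)⁻¹ Σ_ι Σ_x Ξ_ι(x) ≤ P⃗^ι · (B^n · (Ā^ι)'_avg) · P⃗^E`.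
[cite: FitznerVanDerHofstad2017, Prop. 5.6 (5.37) (arXiv:1506.07977v2 p. 53); §6.2.1 ("The proof for Ξ^ι differs only in the different initial block", p. 67); §6.1 (6.x) (p. 59); §5.1 p. 49] -/
theorem invTwoD_mul_sum_tsum_le_of_cover (n : ℕ) (Ξι : Fin d × Bool → Site d → ℝ≥0∞)
    (E : Fin d × Bool → Site d → (Fin (n + 1) → Site d × Site d) → (Fin (n + 1) → Site d) →
      (Fin (n + 1) → Site d) → (Fin (n + 1) → Site d) → Set (Fin (n + 2) → BondConfig (Site d)))
    (C : Fin d × Bool → Site d → (Fin (n + 1) → Site d × Site d) → (Fin (n + 1) → Site d) →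
      (Fin (n + 1) → Site d) → (Fin (n + 1) → Site d) → (Fin (n + 1) → Fin 3) → Fin 3 →
        Set (Fin (n + 2) → BondConfig (Site d)))
    (hC : ∀ ι x b w t z, E ι x b w t z ⊆ ⋃ a, ⋃ c, C ι x b w t z a c)
    (h1 : ∀ ι x, Ξι ι x ≤ ∑' b : Fin (n + 1) → Site d × Site d, ∑' w : Fin (n + 1) → Site d,
      ∑' t : Fin (n + 1) → Site d, ∑' z : Fin (n + 1) → Site d,
        (∏ i, ENNReal.ofReal (bondJ d p ((b i).2 - (b i).1))) * piPerc d p (n + 2) (E ι x b w t z))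
    (h2 : ∀ ι x (a : Fin (n + 1) → Fin 3) (c : Fin 3) (b : Fin (n + 1) → Site d × Site d)
      (w t z : Fin (n + 1) → Site d),
      (∏ i, ENNReal.ofReal (bondJ d p ((b i).2 - (b i).1))) * piPerc d p (n + 2) (E ι x b w t z ∩ C ι x b w t z a c) ≤
        ∑ κ : Fin (n + 1) → Fin d × Bool, dirInd stepVec κ b *
          ((kdeltaPref ι (κ 0) (a 0) (b 0).1 (w 0) + blockPiota 𝐋 ι (a 0) (b 0).1 (w 0)) *
            chainTail (blockBFullpt 𝐋) (blockAbar' 𝐋) (blockPE 𝐋) x n κ a c b w t z)) :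
    invTwoD d * ∑ ι : Fin d × Bool, ∑' x, Ξι ι x ≤
      vecPiota 𝐋 ᵥ* (matB (blockBFull 𝐋) ^ n *
        matAbarAvg (unitVecs d) (fun a : Fin 3 => decide (a = 1)) (blockAbar' 𝐋)) ⬝ᵥ vecPE 𝐋 := by
  refine perc_invTwoD_mul_sum_tsum_le_vecPiota_pow_matAbarAvg_vecPE p Ξι n fun x => ?_
  refine sum_le_recP_chain_of_pointwise stepVec (blockBFull 𝐋) (blockBFullpt 𝐋) (blockBFullpt_hBpt 𝐋)
    (blockAbar' 𝐋) (blockPE 𝐋) x n (piotaFull 𝐋)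
    (fun ι κ a u w => kdeltaPref ι κ a u w + blockPiota 𝐋 ι a u w)
    (fun κ a u w => sum_kdeltaPref_add_blockPiota_le_piotaFull 𝐋 κ a u w) (fun ι => Ξι ι x)
    (fun ι b w t z => (∏ i, ENNReal.ofReal (bondJ d p ((b i).2 - (b i).1))) * piPerc d p (n + 2) (E ι x b w t z))
    (fun ι => h1 ι x) fun ι b w t z => ?_
  exact mul_measure_le_sum₃_of_cover (piPerc d p (n + 2)) (E ι x b w t z) (C ι x b w t z) (hC ι x b w t z) _
    (fun κ a c => dirInd stepVec κ b * ((kdeltaPref ι (κ 0) (a 0) (b 0).1 (w 0) + blockPiota 𝐋 ι (a 0) (b 0).1 (w 0)) *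
      chainTail (blockBFullpt 𝐋) (blockAbar' 𝐋) (blockPE 𝐋) x n κ a c b w t z)) fun a c => h2 ι x a c b w t z

end Perc

end Literature.Probability.FitznerVanDerHofstad2017

end
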